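import Summits.NavierStokesRegularity.NavierStokesRegularity.Theorems.FilamentSkeletonRssSkeletonJ1RLiaLipschitzTools
import Summits.NavierStokesRegularity.NavierStokesRegularity.Theorems.FilamentSkeletonRssSkeletonJ1RLiaSliced
import Summits.NavierStokesRegularity.NavierStokesRegularity.Theorems.FilamentSkeletonRssSkeletonJ1RLiaSelfSplit

/-!
# Route `FilamentSkeletonRss` · crux `SkeletonJ1R` (stmt-NavierStokesRegularity-23610) · stub F2 `LiaDefectL` — ENVELOPE BRICK (E2):
# the LINEAR curvature envelope and the curvature-Lipschitz constant of the LIA reference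

Lead `ns-fsr-lead-23610` (g2), line `streamline_kantorovich_R` (skeleton of record v5).  Helper file `--supports stmt-NavierStokesRegularity-23610`;
route-independent (no `Theses` import).  Inputs of the self-strand estimate `…SkeletonJ1RLiaSelfEnvelope.selfStrand_sub_lia_le` (brick S3), produced
for THE local-induction reference `IsLiaReference` (`x″ = β⁻¹ φ(x) • x′ × W(x)`, `β = liaCoeff = Γγ_j log Γ/(8π)`):
* `IsLiaReference.dist_partner_ge_of_tilt` — a reference with global tilt `≤ θ₁` (inside the partner-distance budget) stays at perpendicular distance
  `≥ (ρ/2)√Γ` from every partner datum line, at ALL parameters (both arcs; the landed one-sided `dist_partner_ge_of_nearStraightOn`);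
* `IsLiaReference.norm_le` — `‖x_j σ‖ ≤ ‖w_j‖ + |σ|`;
* `IsLiaReference.curvature_envelope` — `‖x_j″ σ‖ ≤ |β⁻¹|·(B_d + (½+|α|)(‖w_j‖ + |σ|))`, `B_d = Σ_{k≠j} |Γγ_k/4π|·2/d`: the envelope is LINEAR in `|σ|`
  (the landed `curvCeil` is its value at the edge of the support, too large for the logarithmic window);
* `IsLiaReference.curvature_sub_le` — two-point Lipschitz bound `‖x_j″ q − x_j″ τ‖ ≤ |β⁻¹|·(C·2B_x/ℓ²·W + κ·W + L_W)·|q − τ|` from brick E1's two-point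
  bounds for the cutoff (`C` a Lipschitz constant of `Real.smoothTransition`) and the ambient field (`L_W = Σ|Γγ_k/4π|·6/d² + ½ + |α|`).
HONEST FRAMING: MODEL rung, ∃-side helper lemmas toward stub F2 of a HYPOTHETICAL filament-type blow-up skeleton; F2 and the crux 23610 stay OPEN;
nothing here bears on Navier–Stokes regularity, which is NOT proved. [folklore]
-/

-- `dupNamespace` off: the module name repeats `NavierStokesRegularity` by the tree's `Summits/<S>/<S>/Theorems` layout (same as every sibling file).
set_option linter.dupNamespace false

noncomputable section

namespace Summit.NavierStokesRegularity.NavierStokesRegularity.Theorems.SkeletonJ1RFrame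

open Set Function Filter Real Topology
open Literature.Analysis.FluidPDE
open Summit.NavierStokesRegularity.NavierStokesRegularity.Theorems.SkeletonJ1RLiaSelf (norm_deriv_sub_deriv_le_on)
open scoped InnerProductSpace BigOperators

variable {N : ℕ} {Γ Rb ρ θd : ℝ} {p t : Fin N → EuclideanSpace ℝ (Fin 3)} {γ : Fin N → ℝ} {α : ℝ} {s₀ : Fin N → ℝ}
  {x : Fin N → ℝ → EuclideanSpace ℝ (Fin 3)}

/-! ## §1 Partner distance along the whole reference -/

/-- **Partner distance along the whole reference.**  Datum: unit directions, general position `θd ∈ (0,1]`, separation `ρ > 0`; a tilt budget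
`0 ≤ θ₁ ≤ min (√θd/4) (θd ρ/(16(‖q_j − q_k‖ + ρ)))` for all `k ≠ j`.  If the LIA reference `x_j` has tilt `≤ θ₁` EVERYWHERE, then for every `σ` and
every `k ≠ j`: `((ρ/2)√Γ)² ≤ ‖x_j σ − w_k‖² − ⟪x_j σ − w_k, t_k⟫²`. [folklore] -/
theorem IsLiaReference.dist_partner_ge_of_tilt (hx : IsLiaReference Γ Rb p t γ α s₀ x) (ht : ∀ k, ‖t k‖ = 1) (hθd : 0 < θd)
    (hθd1 : θd ≤ 1) (hgp : ∀ j k, j ≠ k → |inner ℝ (t j) (t k)| ≤ 1 - θd) (hρ : 0 < ρ)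
    (hsep : ∀ j k, j ≠ k → ∀ a b : ℝ, ρ ≤ ‖(p j + a • t j) - (p k + b • t k)‖) (j : Fin N) {θ₁ : ℝ} (hθ₁0 : 0 ≤ θ₁)
    (hθ₁A : ∀ k, k ≠ j → θ₁ ≤ min (Real.sqrt θd / 4) (θd * ρ / (16 * (‖(p j + s₀ j • t j) - (p k + s₀ k • t k)‖ + ρ))))
    (htilt : ∀ σ, ‖deriv (x j) σ - t j‖ ≤ θ₁) (σ : ℝ) :
    ∀ k, k ≠ j → (ρ / 2 * Real.sqrt Γ) ^ 2 ≤ ‖x j σ - waistPt Γ p t s₀ k‖ ^ 2 - (inner ℝ (x j σ - waistPt Γ p t s₀ k) (t k)) ^ 2 := by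
  -- adapted from the two arcs of `IsLiaReference.curvature_le_of_tiltOn{,_neg}` (…SkeletonJ1RLiaSliced)
  intro k hk
  obtain ⟨hC2, hunit, h0, h0', hode⟩ := hx j
  have hA := hθ₁A k hk
  rw [waistPt_eq]
  rcases le_total 0 σ with hσ | hσ
  · exact dist_partner_ge_of_nearStraightOn (hC2.of_le (by norm_num)) (ht j) (ht k) hθd hθd1 (hgp j k hk.symm) hρ
      (fun a b => datum_sep_waist hsep hk.symm a b) (by rw [h0, waistPt_eq]) hθ₁0
      ((le_min_iff.1 hA).1.trans (sqrt_quarter_le_sqrt_half_half θd)) (le_min_iff.1 hA).2 (T := σ) (fun s _ => htilt s) ⟨hσ, le_rfl⟩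
  · set y : ℝ → EuclideanSpace ℝ (Fin 3) := fun s => x j (-s) with hy
    have hyC : ContDiff ℝ 1 y := (hC2.of_le (by norm_num)).comp contDiff_neg
    have hyd : ∀ s, deriv y s = -deriv (x j) (-s) := fun s => by rw [hy]; exact deriv_comp_neg (f := x j) (x := s)
    have hytilt : ∀ s ∈ Icc 0 (-σ), ‖deriv y s - -t j‖ ≤ θ₁ := by
      intro s _
      rw [hyd, show -deriv (x j) (-s) - -t j = -(deriv (x j) (-s) - t j) by abel, norm_neg]
      exact htilt (-s)
    have hnt : ‖-t j‖ = 1 := by rw [norm_neg, ht j]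
    have hgp' : |inner ℝ (-t j) (t k)| ≤ 1 - θd := by rw [inner_neg_left, abs_neg]; exact hgp j k hk.symm
    have hsep' : ∀ a b : ℝ, ρ ≤ ‖(p j + s₀ j • t j + a • -t j) - (p k + s₀ k • t k + b • t k)‖ := by
      intro a b
      have h := datum_sep_waist (s₀ := s₀) hsep hk.symm (-a) b
      rwa [neg_smul, ← smul_neg] at h
    have h := dist_partner_ge_of_nearStraightOn hyC hnt (ht k) hθd hθd1 hgp' hρ hsep'
      (by simp only [hy, neg_zero]; rw [h0, waistPt_eq]) hθ₁0
      ((le_min_iff.1 hA).1.trans (sqrt_quarter_le_sqrt_half_half θd)) (le_min_iff.1 hA).2 hytilt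
      (τ := -σ) ⟨by linarith, le_rfl⟩
    simpa only [hy, neg_neg] using h

/-! ## §2 The linear curvature envelope -/

/-- `‖x_j σ‖ ≤ ‖w_j‖ + |σ|` (unit speed from the waist). [folklore] -/
theorem IsLiaReference.norm_le (hx : IsLiaReference Γ Rb p t γ α s₀ x) (j : Fin N) (σ : ℝ) :
    ‖x j σ‖ ≤ ‖waistPt Γ p t s₀ j‖ + |σ| := by
  obtain ⟨hC2, hunit, h0, -, -⟩ := hx j
  have hd : Differentiable ℝ (x j) := hC2.differentiable (by norm_num)
  have h := Convex.norm_image_sub_le_of_norm_deriv_le (f := x j) (C := 1) (s := Set.univ) (fun y _ => hd y)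
    (fun y _ => (hunit y).le) convex_univ (Set.mem_univ 0) (Set.mem_univ σ)
  rw [one_mul, sub_zero, Real.norm_eq_abs, h0] at h
  calc ‖x j σ‖ = ‖waistPt Γ p t s₀ j + (x j σ - waistPt Γ p t s₀ j)‖ := by rw [add_sub_cancel]
    _ ≤ ‖waistPt Γ p t s₀ j‖ + ‖x j σ - waistPt Γ p t s₀ j‖ := norm_add_le _ _
    _ ≤ ‖waistPt Γ p t s₀ j‖ + |σ| := by linarith

/-- **Linear curvature envelope.**  If `x_j σ` is at perpendicular distance `≥ d > 0` from every partner datum line, then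
`‖x_j″ σ‖ ≤ |β_j⁻¹|·(Σ_{k≠j} |Γγ_k/4π|·(2/d) + (½ + |α|)(‖w_j‖ + |σ|))`. [folklore] -/
theorem IsLiaReference.curvature_envelope (hx : IsLiaReference Γ Rb p t γ α s₀ x) (ht : ∀ k, ‖t k‖ = 1) (j : Fin N) (σ : ℝ)
    {d : ℝ} (hd : 0 < d)
    (hfar : ∀ k, k ≠ j → d ^ 2 ≤ ‖x j σ - waistPt Γ p t s₀ k‖ ^ 2 - (inner ℝ (x j σ - waistPt Γ p t s₀ k) (t k)) ^ 2) :
    ‖deriv (deriv (x j)) σ‖ ≤ |(liaCoeff Γ γ j)⁻¹| *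
      ((∑ k ∈ Finset.univ.erase j, |Γ*γ k/(4*Real.pi)| * (2 / d)) + (1/2 + |α|) * (‖waistPt Γ p t s₀ j‖ + |σ|)) := by
  have h1 := hx.norm_iteratedDeriv_two_le j σ
  rw [iteratedDeriv_succ, iteratedDeriv_one] at h1
  have hW := norm_ambientField_le Γ p t γ α s₀ ht j (x j σ) hd hfar
  refine h1.trans (mul_le_mul_of_nonneg_left (hW.trans (add_le_add le_rfl ?_)) (abs_nonneg _))
  exact mul_le_mul_of_nonneg_left (hx.norm_le j σ) (by positivity)

/-! ## §3 The curvature is Lipschitz along the reference -/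

/-- **Two-point curvature bound.**  `C` a Lipschitz constant of `Real.smoothTransition`; `ℓ = Rb√(Γ log Γ) ≠ 0`; two parameters `q, τ` at which the
reference is at perpendicular distance `≥ d > 0` from every partner line and has `‖x_j q‖, ‖x_j τ‖ ≤ B_x`; curvature `≤ κ` on `[[τ, q]]`.  With
`W := Σ_{k≠j}|Γγ_k/4π|·(2/d) + (½+|α|)B_x` and `L_W := Σ_{k≠j}|Γγ_k/4π|·(6/d²) + ½ + |α|`:
`‖x_j″ q − x_j″ τ‖ ≤ |β_j⁻¹|·(C·2B_x/ℓ²·W + κ·W + L_W)·|q − τ|`. [folklore] -/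
theorem IsLiaReference.curvature_sub_le (hx : IsLiaReference Γ Rb p t γ α s₀ x) (ht : ∀ k, ‖t k‖ = 1) (j : Fin N)
    {C : ℝ} (hC0 : 0 ≤ C) (hC : ∀ a b : ℝ, |Real.smoothTransition a - Real.smoothTransition b| ≤ C * |a - b|)
    (hℓ : Rb * Real.sqrt (Γ * Real.log Γ) ≠ 0) {d Bx κ : ℝ} (hd : 0 < d) (hBx : 0 ≤ Bx) {q τ : ℝ}
    (hfarq : ∀ k, k ≠ j → d ^ 2 ≤ ‖x j q - waistPt Γ p t s₀ k‖ ^ 2 - (inner ℝ (x j q - waistPt Γ p t s₀ k) (t k)) ^ 2)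
    (hfarτ : ∀ k, k ≠ j → d ^ 2 ≤ ‖x j τ - waistPt Γ p t s₀ k‖ ^ 2 - (inner ℝ (x j τ - waistPt Γ p t s₀ k) (t k)) ^ 2)
    (hxq : ‖x j q‖ ≤ Bx) (hxτ : ‖x j τ‖ ≤ Bx) (hκ : ∀ r ∈ uIcc τ q, ‖deriv (deriv (x j)) r‖ ≤ κ) :
    ‖deriv (deriv (x j)) q - deriv (deriv (x j)) τ‖ ≤ |(liaCoeff Γ γ j)⁻¹| *
      (C * (2 * Bx) / (Rb * Real.sqrt (Γ * Real.log Γ)) ^ 2 *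
          ((∑ k ∈ Finset.univ.erase j, |Γ*γ k/(4*Real.pi)| * (2 / d)) + (1/2 + |α|) * Bx) +
        κ * ((∑ k ∈ Finset.univ.erase j, |Γ*γ k/(4*Real.pi)| * (2 / d)) + (1/2 + |α|) * Bx) +
        ((∑ k ∈ Finset.univ.erase j, |Γ*γ k/(4*Real.pi)| * (6 / d ^ 2)) + (1/2 + |α|))) * |q - τ| := by
  obtain ⟨hC2, hunit, h0, h0', hode⟩ := hx j
  set ℓ := Rb * Real.sqrt (Γ * Real.log Γ) with hℓdef
  set β := liaCoeff Γ γ j with hβ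
  set Wb : ℝ := (∑ k ∈ Finset.univ.erase j, |Γ*γ k/(4*Real.pi)| * (2 / d)) + (1/2 + |α|) * Bx with hWb
  set LW : ℝ := (∑ k ∈ Finset.univ.erase j, |Γ*γ k/(4*Real.pi)| * (6 / d ^ 2)) + (1/2 + |α|) with hLW
  set φq := refCutoff ℓ (x j q) with hφq
  set φτ := refCutoff ℓ (x j τ) with hφτ
  set Wq := ambientField Γ p t γ α s₀ j (x j q) with hWq
  set Wτ := ambientField Γ p t γ α s₀ j (x j τ) with hWτ
  have hκ0 : 0 ≤ κ := le_trans (norm_nonneg _) (hκ τ left_mem_uIcc)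
  -- sizes
  have hWq : ‖Wq‖ ≤ Wb := by
    have h := norm_ambientField_le Γ p t γ α s₀ ht j (x j q) hd hfarq
    exact h.trans (by rw [hWb]; nlinarith [mul_le_mul_of_nonneg_left hxq (by positivity : (0:ℝ) ≤ 1/2 + |α|)])
  have hWb0 : 0 ≤ Wb := le_trans (norm_nonneg _) hWq
  have hφτ1 : |φτ| ≤ 1 := by
    have h := refCutoff_mem_Icc ℓ (x j τ)
    rw [abs_le]; exact ⟨by linarith [h.1], h.2⟩
  have hdx : ‖x j q - x j τ‖ ≤ |q - τ| := by
    have hdiff : Differentiable ℝ (x j) := hC2.differentiable (by norm_num)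
    have h := Convex.norm_image_sub_le_of_norm_deriv_le (f := x j) (C := 1) (s := Set.univ) (fun y _ => hdiff y)
      (fun y _ => (hunit y).le) convex_univ (Set.mem_univ τ) (Set.mem_univ q)
    rwa [one_mul, Real.norm_eq_abs] at h
  -- the three differences
  have hdφ : |φq - φτ| ≤ C * (2 * Bx) / ℓ ^ 2 * |q - τ| := by
    have h := abs_refCutoff_sub_le hC0 hC hℓ (x j q) (x j τ)
    have hℓ2 : 0 < ℓ ^ 2 := by positivity
    calc |φq - φτ| ≤ C * (‖x j q‖ + ‖x j τ‖) * ‖x j q - x j τ‖ / ℓ ^ 2 := h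
      _ ≤ C * (2 * Bx) * |q - τ| / ℓ ^ 2 := by gcongr; linarith
      _ = C * (2 * Bx) / ℓ ^ 2 * |q - τ| := by ring
  have hdT : ‖deriv (x j) q - deriv (x j) τ‖ ≤ κ * |q - τ| := norm_deriv_sub_deriv_le_on hC2 hκ
  have hdW : ‖Wq - Wτ‖ ≤ LW * |q - τ| :=
    (norm_ambientField_sub_le Γ p t γ α s₀ ht j hd hfarq hfarτ).trans (mul_le_mul_of_nonneg_left hdx (by positivity))
  -- the identity
  have heq : deriv (deriv (x j)) q - deriv (deriv (x j)) τ =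
      β⁻¹ • ((φq - φτ) • cross (deriv (x j) q) Wq + φτ • cross (deriv (x j) q - deriv (x j) τ) Wq +
        φτ • cross (deriv (x j) τ) (Wq - Wτ)) := by
    have h2 : deriv (deriv (x j)) = iteratedDeriv 2 (x j) := by rw [iteratedDeriv_succ, iteratedDeriv_one]
    rw [h2, hode q, hode τ]
    change (β⁻¹ * φq) • cross (deriv (x j) q) Wq - (β⁻¹ * φτ) • cross (deriv (x j) τ) Wτ = _
    have e1 : cross (deriv (x j) q - deriv (x j) τ) Wq = cross (deriv (x j) q) Wq - cross (deriv (x j) τ) Wq := by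
      rw [← crossCLM_apply, ← crossCLM_apply, ← crossCLM_apply, map_sub]; rfl
    have e2 : cross (deriv (x j) τ) (Wq - Wτ) = cross (deriv (x j) τ) Wq - cross (deriv (x j) τ) Wτ := by
      rw [← crossCLM_apply, ← crossCLM_apply, ← crossCLM_apply, map_sub]
    rw [e1, e2]
    simp only [mul_smul, smul_sub, sub_smul, smul_add]
    abel
  rw [heq, norm_smul, Real.norm_eq_abs, mul_assoc]
  refine mul_le_mul_of_nonneg_left ?_ (abs_nonneg _)
  have n1 : ‖(φq - φτ) • cross (deriv (x j) q) Wq‖ ≤ C * (2 * Bx) / ℓ ^ 2 * |q - τ| * Wb := by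
    rw [norm_smul, Real.norm_eq_abs]
    refine mul_le_mul hdφ ?_ (norm_nonneg _) (by positivity)
    have h := norm_cross_le_norm_mul_norm (deriv (x j) q) Wq
    rw [hunit q, one_mul] at h
    exact h.trans hWq
  have n2 : ‖φτ • cross (deriv (x j) q - deriv (x j) τ) Wq‖ ≤ κ * |q - τ| * Wb := by
    rw [norm_smul, Real.norm_eq_abs]
    calc |φτ| * ‖cross (deriv (x j) q - deriv (x j) τ) Wq‖ ≤ 1 * (‖deriv (x j) q - deriv (x j) τ‖ * ‖Wq‖) :=
          mul_le_mul hφτ1 (norm_cross_le_norm_mul_norm _ _) (norm_nonneg _) zero_le_one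
      _ ≤ 1 * (κ * |q - τ| * Wb) := by
          refine mul_le_mul_of_nonneg_left (mul_le_mul hdT hWq (norm_nonneg _) (by positivity)) zero_le_one
      _ = κ * |q - τ| * Wb := one_mul _
  have n3 : ‖φτ • cross (deriv (x j) τ) (Wq - Wτ)‖ ≤ LW * |q - τ| := by
    rw [norm_smul, Real.norm_eq_abs]
    calc |φτ| * ‖cross (deriv (x j) τ) (Wq - Wτ)‖ ≤ 1 * (‖deriv (x j) τ‖ * ‖Wq - Wτ‖) :=
          mul_le_mul hφτ1 (norm_cross_le_norm_mul_norm _ _) (norm_nonneg _) zero_le_one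
      _ ≤ LW * |q - τ| := by rw [hunit τ, one_mul, one_mul]; exact hdW
  calc ‖(φq - φτ) • cross (deriv (x j) q) Wq + φτ • cross (deriv (x j) q - deriv (x j) τ) Wq + φτ • cross (deriv (x j) τ) (Wq - Wτ)‖
      ≤ ‖(φq - φτ) • cross (deriv (x j) q) Wq‖ + ‖φτ • cross (deriv (x j) q - deriv (x j) τ) Wq‖ +
          ‖φτ • cross (deriv (x j) τ) (Wq - Wτ)‖ := norm_add₃_le
    _ ≤ C * (2 * Bx) / ℓ ^ 2 * |q - τ| * Wb + κ * |q - τ| * Wb + LW * |q - τ| := add_le_add (add_le_add n1 n2) n3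
    _ = (C * (2 * Bx) / ℓ ^ 2 * Wb + κ * Wb + LW) * |q - τ| := by ring

end Summit.NavierStokesRegularity.NavierStokesRegularity.Theorems.SkeletonJ1RFrame

end
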